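import Summits.ValiantsHypothesis.ValiantsHypothesis.Theses.DecompCycle1C

/-!
# `DecompCycle1C.Assembly` holds (bookkeeping item 23609 closed by proof)

The assembly item of route `DecompCycle1C` (decomp-valiant workshop cycle 1 = VALIANT, writer file;
OR-sibling / history of node N2, the lens-3 boundary square, whose node of record is
`VPBoundarySquare`) is the implication
`CircuitDeborderedMulmuleySohoni → CollapseToBorderDet → CollapseDebordersIntoCircuits → ValiantsHypothesis`,
which is literally the route's certified deciding theorem `closes` (D-0027 §2.1: if `VP = VNP` then
`VNP ⊆ \overline{VP}` (P2) and the collapse deborders circuits (P3), so P1′ separates the permanent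
from debordered border classes — contradiction).  It is closed here so that no decorative item
remains open on the route (workshop critic, bus 527, 2026-08-30T07:57:31Z, principle (i)); the
route's open content is unchanged: crux `CircuitDeborderedMulmuleySohoni` (item 23599), the declared
residuals `CollapseToBorderDet` (23564) / `CollapseDebordersIntoCircuits` (23565) and the record
asides.  No tag, no rung changes (LADDER-Valiant rung 0; VP ≠ VNP is not proved by anything here).
-/

set_option linter.dupNamespace false

namespace Summit.ValiantsHypothesis.ValiantsHypothesis.Theorems.DecompCycle1CAssembly

/-- **Item 23609 (`DecompCycle1C.Assembly`) holds**:
`CircuitDeborderedMulmuleySohoni → CollapseToBorderDet → CollapseDebordersIntoCircuits → VP_ℂ ≠ VNP_ℂ`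
is the route's deciding theorem `closes`.
[cite: BurgisserEtAl2011, §9.3 (closure of VP and the debordering question)] -/
theorem assembly_holds :
    Summit.ValiantsHypothesis.ValiantsHypothesis.Theses.DecompCycle1C.Assembly :=
  fun h₁ h₂ h₃ => Summit.ValiantsHypothesis.ValiantsHypothesis.Theses.DecompCycle1C.closes h₁ h₂ h₃

end Summit.ValiantsHypothesis.ValiantsHypothesis.Theorems.DecompCycle1CAssembly
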